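import Literature.Barriers.RiemannHypothesis.TuranPartialSumsWindowCheck
import Literature.Barriers.RiemannHypothesis.TuranPartialSumsHsum
import Mathlib.Analysis.SpecialFunctions.Trigonometric.Bounds
import Mathlib.Analysis.Complex.Trigonometric
import HarnessLib

/-!
# Sections of `ζ` beyond `σ = 1`: soundness of the window checker, I (arithmetic helpers)

Barrier catalogue `Literature/Barriers/RiemannHypothesis/`, companion of
`TuranPartialSumsWindowCheck.lean` (step U3 of the plan to prove `TuranPartialSums`). Inclusion
("soundness") theorems for the helper functions of the checker: the rescaled kernel logarithms
(`mem_logFI`, `mem_log1pFI`, `logUp_spec`, `logDown_spec`), the checked integer square root and the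
modulus bounds of a box (`absLoCB_le`, `le_absHiCB`), the phase boxes (`mem_phaseBox`,
`cosSinSmall_spec`, `mem_arcPos`, `mem_arcNeg`, `phaseDown_spec`, `phaseUp_spec`), the grid
(`gridPt_succ`, `gridPt_lt_succ`, `gridDesc_succ`), the table of `H_k(s)` (`hTab_spec`,
`mem_hTabHull`) and the Euler–Maclaurin box (`mem_emBox`, from `TuranPartialSumsHsum`). Everything here
is PROVED; the phases are `t^{-iτ} = e^{-iτ log t}` (`phase τ (log t)`), `s = 1 + iτ`
(`natCast_cpow_neg_sOf`).

## References

* [PlattTrudgian2016] D. J. Platt, T. S. Trudgian, LMS J. Comput. Math. 19 (2016), §2.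
-/

noncomputable section

open Literature.Analysis.ValidatedNumerics.Numerics
open Literature.Analysis.SpecialFunctions.KernelLog
open Complex

namespace Literature.Barriers.RiemannHypothesis.TuranWindow

/-! ### Scale -/

/-- `SCZ = SC` (as integers). [folklore] -/
theorem SCZ_eq : SCZ = (SC : ℤ) := by rw [SC_eq]; norm_num [SCZ]

/-- `SCZ = 2^48` in `ℝ`. [folklore] -/
theorem SCZ_cast : ((SCZ : ℤ) : ℝ) = (SC : ℝ) := by rw [SCZ_eq]; simp

/-- `SC = 2^48` in `ℝ`. [folklore] -/
theorem SC_cast : (SC : ℝ) = 2 ^ 48 := by rw [SC_eq]; norm_num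

/-! ### The phase and the exponent -/

/-- `phase τ y = e^{-iτ y}` (so that `t^{-iτ} = phase τ (log t)`). [folklore] -/
def phase (τ y : ℝ) : ℂ := Complex.exp (((-(τ * y) : ℝ) : ℂ) * I)

/-- `s = 1 + iτ`. [folklore] -/
def sOf (τ : ℝ) : ℂ := 1 + (τ : ℂ) * I

/-- `Re s = 1`. [folklore] -/
theorem sOf_re (τ : ℝ) : (sOf τ).re = 1 := by simp [sOf]

/-- `s ≠ 1` for `τ ≠ 0`. [folklore] -/
theorem sOf_ne_one {τ : ℝ} (hτ : τ ≠ 0) : sOf τ ≠ 1 := by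
  intro h
  have := congrArg Complex.im h
  simp [sOf] at this
  exact hτ this

/-- `1 − s = −iτ`. [folklore] -/
theorem one_sub_sOf (τ : ℝ) : 1 - sOf τ = -((τ : ℂ) * I) := by simp [sOf]

/-- `‖phase τ y‖ = 1`. [folklore] -/
theorem norm_phase (τ y : ℝ) : ‖phase τ y‖ = 1 := by
  rw [phase, Complex.norm_exp_ofReal_mul_I]

/-- `phase τ (y + y') = phase τ y · phase τ y'`. [folklore] -/
theorem phase_add (τ y y' : ℝ) : phase τ (y + y') = phase τ y * phase τ y' := by
  simp only [phase, ← Complex.exp_add]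
  congr 1
  push_cast
  ring

/-- `phase τ y = phase τ y' · e^{i τ (y' − y)}`. [folklore] -/
theorem phase_eq_mul_exp (τ y y' : ℝ) :
    phase τ y = phase τ y' * Complex.exp (((τ * (y' - y) : ℝ) : ℂ) * I) := by
  rw [phase, phase, ← Complex.exp_add]
  congr 1
  push_cast
  ring

/-- `phase τ y = phase τ y' · e^{-i τ (y − y')}`. [folklore] -/
theorem phase_eq_mul_exp_neg (τ y y' : ℝ) :
    phase τ y = phase τ y' * Complex.exp (((-(τ * (y - y')) : ℝ) : ℂ) * I) := by
  rw [phase_eq_mul_exp τ y y']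
  congr 2
  push_cast
  ring

/-- `n^{1−s} = n^{-iτ} = phase τ (log n)` for a natural `n ≥ 1`. [folklore] -/
theorem natCast_cpow_one_sub_sOf {n : ℕ} (hn : 0 < n) (τ : ℝ) :
    (n : ℂ) ^ (1 - sOf τ) = phase τ (Real.log n) := by
  have hn0 : (n : ℂ) ≠ 0 := by exact_mod_cast hn.ne'
  rw [Complex.cpow_def_of_ne_zero hn0, one_sub_sOf, phase, ← Complex.natCast_log]
  congr 1
  push_cast
  ring

/-- `n^{-s} = n⁻¹ · phase τ (log n)` for a natural `n ≥ 1`. [folklore] -/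
theorem natCast_cpow_neg_sOf {n : ℕ} (hn : 0 < n) (τ : ℝ) :
    (n : ℂ) ^ (-(sOf τ)) = ((n : ℂ))⁻¹ * phase τ (Real.log n) := by
  have hn0 : (n : ℂ) ≠ 0 := by exact_mod_cast hn.ne'
  rw [Complex.cpow_def_of_ne_zero hn0, sOf, phase, ← Complex.natCast_log]
  have : ((Real.log n : ℝ) : ℂ) * -(1 + (τ : ℂ) * I) =
      -((Real.log n : ℝ) : ℂ) + ((-(τ * Real.log n) : ℝ) : ℂ) * I := by
    push_cast; ring
  rw [this, Complex.exp_add]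
  congr 1
  rw [Complex.exp_neg, ← Complex.ofReal_exp, Real.exp_log (by exact_mod_cast hn)]
  push_cast
  rfl

/-- `‖s‖ ≤ 1 + τ²/2`. [folklore] -/
theorem norm_sOf_le (τ : ℝ) : ‖sOf τ‖ ≤ 1 + τ ^ 2 / 2 := by
  have h1 : ‖sOf τ‖ ^ 2 = 1 + τ ^ 2 := by
    rw [sOf, Complex.sq_norm, Complex.normSq_apply]
    simp; ring
  have h2 : (1 + τ ^ 2 / 2) ^ 2 = 1 + τ ^ 2 + τ ^ 4 / 4 := by ring
  have h3 : ‖sOf τ‖ ^ 2 ≤ (1 + τ ^ 2 / 2) ^ 2 := by rw [h1, h2]; nlinarith [sq_nonneg (τ ^ 2)]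
  exact (pow_le_pow_iff_left₀ (norm_nonneg _) (by positivity) two_ne_zero).1 h3

/-! ### Kernel logarithms as `FI` -/

/-- Rescaling `2^80 → 2^48` is sound. [folklore] -/
theorem mem_ofLog80 {x : ℝ} {lo hi : ℤ} (h1 : (lo : ℝ) / 2 ^ 80 ≤ x) (h2 : x ≤ (hi : ℝ) / 2 ^ 80) :
    FI.mem x (ofLog80 (lo, hi)) := by
  rw [FI.mem_def]
  simp only [ofLog80]
  have hd : (0 : ℤ) < 4294967296 := by norm_num
  have e32 : ((4294967296 : ℤ) : ℝ) = 2 ^ 32 := by norm_num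
  constructor
  · have := fdiv_mul_le_real (a := lo) hd
    rw [e32] at this
    rw [SC_cast]
    have hx : (lo : ℝ) ≤ x * 2 ^ 80 := by
      rw [div_le_iff₀ (by positivity)] at h1; exact h1
    nlinarith [this, hx]
  · have := le_cdiv_mul_real (a := hi) hd
    rw [e32] at this
    rw [SC_cast]
    have hx : x * 2 ^ 80 ≤ hi := by
      rw [le_div_iff₀ (by positivity)] at h2; exact h2
    nlinarith [this, hx]

/-- **`logFI n ∋ log n`.** [folklore] -/
theorem mem_logFI {n : ℕ} {L : FI} (h : logFI n = some L) : FI.mem (Real.log n) L := by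
  unfold logFI at h
  split at h
  · rename_i p hp
    simp only [Option.some.injEq] at h
    subst h
    obtain ⟨lo, hi⟩ := p
    have hs := logIv_sound hp
    exact mem_ofLog80 hs.1 hs.2
  · simp at h

/-- **`log1pFI d u ∋ log(1 + d/u)`.** [folklore] -/
theorem mem_log1pFI {d u : ℕ} {L : FI} (h : log1pFI d u = some L) :
    FI.mem (Real.log (1 + (d : ℝ) / u)) L := by
  unfold log1pFI at h
  split at h
  · rename_i p hp
    simp only [Option.some.injEq] at h
    subst h
    obtain ⟨lo, hi⟩ := p
    have hs := log1pIv_sound hp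
    exact mem_ofLog80 hs.1 hs.2
  · simp at h

/-- **`logUp`**: from `L ∋ log a` (when `0 < a`) and `a ≤ b`: the first component `∋ log b`, and an
increment `D`, when returned, satisfies `0 < a` and `D ∋ log b − log a`. [folklore] -/
theorem logUp_spec {L L' : FI} {a b : ℕ} {inc : Option FI} (h : logUp L a b = some (L', inc))
    (hab : a ≤ b) (hL : 0 < a → FI.mem (Real.log a) L) :
    FI.mem (Real.log b) L' ∧
      ∀ D, inc = some D → 0 < a ∧ FI.mem (Real.log b - Real.log a) D := by
  unfold logUp at h
  cases hc : (Nat.ble (2 * (b - a)) a && Nat.blt 0 a)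
  · rw [hc] at h
    simp only [cond_false] at h
    split at h
    · rename_i L'' hL''
      simp only [Option.some.injEq, Prod.mk.injEq] at h
      obtain ⟨rfl, rfl⟩ := h
      exact ⟨mem_logFI hL'', fun D hD ↦ by simp at hD⟩
    · simp at h
  · rw [hc] at h
    simp only [cond_true] at h
    simp only [Bool.and_eq_true, Nat.ble_eq, Nat.blt_eq] at hc
    obtain ⟨_, ha⟩ := hc
    split at h
    · rename_i D hD
      simp only [Option.some.injEq, Prod.mk.injEq] at h
      obtain ⟨rfl, rfl⟩ := h
      have hmD := mem_log1pFI hD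
      have ha' : (0 : ℝ) < a := by exact_mod_cast ha
      have hb' : (0 : ℝ) < b := by exact_mod_cast (lt_of_lt_of_le ha hab)
      have key : Real.log (1 + ((b - a : ℕ) : ℝ) / a) = Real.log b - Real.log a := by
        rw [Nat.cast_sub hab, ← Real.log_div hb'.ne' ha'.ne']
        congr 1
        field_simp
        ring
      rw [key] at hmD
      refine ⟨?_, fun D' hD' ↦ ?_⟩
      · have := FI.mem_add (hL ha) hmD
        simpa using this
      · simp only [Option.some.injEq] at hD'
        subst hD'
        exact ⟨ha, hmD⟩
    · simp at h

/-- **`logDown`**: from `L ∋ log v` and `u ≤ v`: the first component `∋ log u`, and an increment `D`,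
when returned, satisfies `0 < u` and `D ∋ log v − log u`. [folklore] -/
theorem logDown_spec {L L' : FI} {v u : ℕ} {inc : Option FI} (h : logDown L v u = some (L', inc))
    (huv : u ≤ v) (hL : FI.mem (Real.log v) L) :
    FI.mem (Real.log u) L' ∧
      ∀ D, inc = some D → 0 < u ∧ FI.mem (Real.log v - Real.log u) D := by
  unfold logDown at h
  cases hc : (Nat.ble (2 * (v - u)) u && Nat.blt 0 u)
  · rw [hc] at h
    simp only [cond_false] at h
    split at h
    · rename_i L'' hL''
      simp only [Option.some.injEq, Prod.mk.injEq] at h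
      obtain ⟨rfl, rfl⟩ := h
      exact ⟨mem_logFI hL'', fun D hD ↦ by simp at hD⟩
    · simp at h
  · rw [hc] at h
    simp only [cond_true] at h
    simp only [Bool.and_eq_true, Nat.ble_eq, Nat.blt_eq] at hc
    obtain ⟨_, hu⟩ := hc
    split at h
    · rename_i D hD
      simp only [Option.some.injEq, Prod.mk.injEq] at h
      obtain ⟨rfl, rfl⟩ := h
      have hmD := mem_log1pFI hD
      have hu' : (0 : ℝ) < u := by exact_mod_cast hu
      have hv' : (0 : ℝ) < v := by exact_mod_cast (lt_of_lt_of_le hu huv)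
      have key : Real.log (1 + ((v - u : ℕ) : ℝ) / u) = Real.log v - Real.log u := by
        rw [Nat.cast_sub huv, ← Real.log_div hv'.ne' hu'.ne']
        congr 1
        field_simp
        ring
      rw [key] at hmD
      refine ⟨?_, fun D' hD' ↦ ?_⟩
      · have := FI.mem_sub hL hmD
        simpa using this
      · simp only [Option.some.injEq] at hD'
        subst hD'
        exact ⟨hu, hmD⟩
    · simp at h

/-! ### Square roots and moduli -/

/-- The checked square root bracket. [folklore] -/
theorem isqrtChecked_spec {q s : ℕ} (h : isqrtChecked q = some s) : s * s ≤ q ∧ q < (s + 1) * (s + 1) := by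
  unfold isqrtChecked at h
  simp only at h
  cases hc : (Nat.ble (TuranCheck.isqrt q * TuranCheck.isqrt q) q &&
      Nat.blt q ((TuranCheck.isqrt q + 1) * (TuranCheck.isqrt q + 1)))
  · rw [hc] at h; simp at h
  · rw [hc] at h
    simp only [cond_true, Option.some.injEq] at h
    subst h
    simpa [Bool.and_eq_true, Nat.ble_eq, Nat.blt_eq] using hc

/-- `0 ≤ absLoFI I ≤ |x|·2^48` for `x ∈ I`. [folklore] -/
theorem absLoFI_le {x : ℝ} {I : FI} (hx : FI.mem x I) :
    0 ≤ absLoFI I ∧ ((absLoFI I : ℤ) : ℝ) ≤ |x| * SC := by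
  rw [FI.mem_def] at hx
  unfold absLoFI
  split_ifs with h1 h2
  · refine ⟨h1, ?_⟩
    have : (0 : ℝ) ≤ I.lo := by exact_mod_cast h1
    calc ((I.lo : ℤ) : ℝ) ≤ x * SC := hx.1
      _ ≤ |x| * SC := by gcongr; exact le_abs_self x
  · refine ⟨by linarith, ?_⟩
    push_cast
    have : x * SC ≤ I.hi := hx.2
    have hsc : (0 : ℝ) < SC := SC_pos
    calc -((I.hi : ℤ) : ℝ) ≤ -(x * SC) := by linarith
      _ = (-x) * SC := by ring
      _ ≤ |x| * SC := by gcongr; exact neg_le_abs x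
  · exact ⟨le_rfl, by push_cast; positivity⟩

/-- **Lower modulus bound of a box**: `absLoCB B = some m` gives `0 ≤ m ≤ |z|·2^48` on the box. [folklore] -/
theorem absLoCB_le {z : ℂ} {B : CB} {m : ℤ} (h : absLoCB B = some m) (hz : CB.mem z B) :
    0 ≤ m ∧ (m : ℝ) ≤ ‖z‖ * SC := by
  simp only [absLoCB] at h
  split at h
  · rename_i s hs
    simp only [Option.some.injEq] at h
    subst h
    obtain ⟨hss, -⟩ := isqrtChecked_spec hs
    refine ⟨by positivity, ?_⟩
    obtain ⟨ha0, ha⟩ := absLoFI_le hz.1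
    obtain ⟨hb0, hb⟩ := absLoFI_le hz.2
    set a := absLoFI B.re
    set b := absLoFI B.im
    have ha' : ((a.toNat : ℕ) : ℝ) = ((a : ℤ) : ℝ) := by
      rw [show ((a.toNat : ℕ) : ℝ) = ((a.toNat : ℤ) : ℝ) by norm_cast, Int.toNat_of_nonneg ha0]
    have hb' : ((b.toNat : ℕ) : ℝ) = ((b : ℤ) : ℝ) := by
      rw [show ((b.toNat : ℕ) : ℝ) = ((b.toNat : ℤ) : ℝ) by norm_cast, Int.toNat_of_nonneg hb0]
    have hsq : ((s : ℝ)) ^ 2 ≤ (|z.re| * SC) ^ 2 + (|z.im| * SC) ^ 2 := by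
      have h1 : ((s * s : ℕ) : ℝ) ≤ ((a.toNat * a.toNat + b.toNat * b.toNat : ℕ) : ℝ) := by
        exact_mod_cast hss
      push_cast at h1
      rw [ha', hb'] at h1
      have ha2 : ((a : ℤ) : ℝ) ^ 2 ≤ (|z.re| * SC) ^ 2 :=
        pow_le_pow_left₀ (by exact_mod_cast ha0) ha 2
      have hb2 : ((b : ℤ) : ℝ) ^ 2 ≤ (|z.im| * SC) ^ 2 :=
        pow_le_pow_left₀ (by exact_mod_cast hb0) hb 2
      nlinarith
    have hnorm : (|z.re| * SC) ^ 2 + (|z.im| * SC) ^ 2 = (‖z‖ * SC) ^ 2 := by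
      rw [mul_pow, mul_pow, mul_pow, sq_abs, sq_abs, Complex.sq_norm, Complex.normSq_apply]; ring
    rw [hnorm] at hsq
    push_cast
    exact (pow_le_pow_iff_left₀ (by positivity) (by positivity) two_ne_zero).1 hsq
  · simp at h

/-- **Upper modulus bound of a box**: `absHiCB B = some M` gives `|z|·2^48 ≤ M` on the box. [folklore] -/
theorem le_absHiCB {z : ℂ} {B : CB} {M : ℤ} (h : absHiCB B = some M) (hz : CB.mem z B) :
    ‖z‖ * SC ≤ (M : ℝ) := by
  simp only [absHiCB] at h
  split at h
  · rename_i s hs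
    simp only [Option.some.injEq] at h
    subst h
    obtain ⟨-, hlt⟩ := isqrtChecked_spec hs
    have ha := FI.abs_le_absHi hz.1
    have hb := FI.abs_le_absHi hz.2
    set a := B.re.absHi
    set b := B.im.absHi
    have ha0 : 0 ≤ a := le_trans (abs_nonneg _) (le_max_left _ _)
    have hb0 : 0 ≤ b := le_trans (abs_nonneg _) (le_max_left _ _)
    have ha' : ((a.toNat : ℕ) : ℝ) = ((a : ℤ) : ℝ) := by
      rw [show ((a.toNat : ℕ) : ℝ) = ((a.toNat : ℤ) : ℝ) by norm_cast, Int.toNat_of_nonneg ha0]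
    have hb' : ((b.toNat : ℕ) : ℝ) = ((b : ℤ) : ℝ) := by
      rw [show ((b.toNat : ℕ) : ℝ) = ((b.toNat : ℤ) : ℝ) by norm_cast, Int.toNat_of_nonneg hb0]
    have h1 : ((a.toNat * a.toNat + b.toNat * b.toNat : ℕ) : ℝ) < (((s + 1) * (s + 1) : ℕ) : ℝ) := by
      exact_mod_cast hlt
    push_cast at h1
    rw [ha', hb'] at h1
    have hre : (|z.re| * SC) ^ 2 ≤ ((a : ℤ) : ℝ) ^ 2 := pow_le_pow_left₀ (by positivity) ha 2
    have him : (|z.im| * SC) ^ 2 ≤ ((b : ℤ) : ℝ) ^ 2 := pow_le_pow_left₀ (by positivity) hb 2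
    have hnorm : (|z.re| * SC) ^ 2 + (|z.im| * SC) ^ 2 = (‖z‖ * SC) ^ 2 := by
      rw [mul_pow, mul_pow, mul_pow, sq_abs, sq_abs, Complex.sq_norm, Complex.normSq_apply]; ring
    have hsq : (‖z‖ * SC) ^ 2 ≤ ((s : ℝ) + 1) ^ 2 := by nlinarith
    push_cast
    exact (pow_le_pow_iff_left₀ (by positivity) (by positivity) two_ne_zero).1 hsq
  · simp at h

/-- Hull of two boxes contains both. [folklore] -/
theorem mem_hullCB_left {z : ℂ} {A : CB} (hz : CB.mem z A) (B : CB) : CB.mem z (hullCB A B) :=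
  ⟨FI.mem_hull_left hz.1 _, FI.mem_hull_left hz.2 _⟩

/-- [folklore] -/
theorem mem_hullCB_right {z : ℂ} {B : CB} (hz : CB.mem z B) (A : CB) : CB.mem z (hullCB A B) :=
  ⟨FI.mem_hull_right hz.1 _, FI.mem_hull_right hz.2 _⟩

/-! ### Phase boxes -/

/-- **`phaseBox tn td L M ∋ e^{-iτ y}`** for every `y` with `L.lo ≤ 2^48 y ≤ M.hi` (`τ = tn/td`). [folklore] -/
theorem mem_phaseBox {tn td : ℕ} (htd : 0 < td) {L M : FI} {B : CB} (h : phaseBox tn td L M = some B)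
    {y : ℝ} (hy1 : (L.lo : ℝ) ≤ y * SC) (hy2 : y * SC ≤ (M.hi : ℝ)) :
    CB.mem (phase ((tn : ℝ) / td) y) B := by
  unfold phaseBox at h
  have hya : FI.mem y ⟨L.lo, M.hi⟩ := ⟨hy1, hy2⟩
  have hθ : FI.mem (-(y * tn / td)) (((FI.mulInt ⟨L.lo, M.hi⟩ tn).divNat td).neg) :=
    FI.mem_neg (FI.mem_divNat (FI.mem_mulInt hya tn) htd)
  have := CB.mem_expI h hθ
  rw [phase]
  convert this using 2
  push_cast
  ring

/-- **Small-angle cosine/sine.** If `cosSinSmall D = some (c, s)` and `d ∈ D` then `0 ≤ d ≤ 1`,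
`cos d ∈ c` and `sin d ∈ s`. [folklore] -/
theorem cosSinSmall_spec {D c s : FI} {d : ℝ} (h : cosSinSmall D = some (c, s)) (hd : FI.mem d D) :
    0 ≤ d ∧ d ≤ 1 ∧ FI.mem (Real.cos d) c ∧ FI.mem (Real.sin d) s := by
  unfold cosSinSmall at h
  cases hc : (decide (0 ≤ D.lo) && decide (D.hi ≤ SCZ))
  · rw [hc] at h; simp at h
  · rw [hc] at h
    simp only [cond_true, Option.some.injEq, Prod.mk.injEq] at h
    simp only [Bool.and_eq_true, decide_eq_true_eq] at hc
    obtain ⟨hlo, hhi⟩ := hc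
    obtain ⟨rfl, rfl⟩ := h
    rw [FI.mem_def] at hd
    have hsc : (0 : ℝ) < SC := SC_pos
    have hd0 : 0 ≤ d := by
      have : (0 : ℝ) ≤ D.lo := by exact_mod_cast hlo
      nlinarith [hd.1]
    have hd1 : d ≤ 1 := by
      have : (D.hi : ℝ) ≤ SC := by rw [← SCZ_cast]; exact_mod_cast hhi
      nlinarith [hd.2]
    have habs : |d| ≤ 1 := by rw [abs_of_nonneg hd0]; exact hd1
    refine ⟨hd0, hd1, ?_, ?_⟩
    · -- cosine
      have h2 : FI.mem (d ^ 2) D.sqr := FI.mem_sqr hd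
      have h4 : FI.mem ((d ^ 2) ^ 2) D.sqr.sqr := FI.mem_sqr h2
      rw [FI.mem_def] at h2 h4
      have hlow := Real.one_sub_sq_div_two_le_cos (x := d)
      have hup : Real.cos d ≤ 1 - d ^ 2 / 2 + d ^ 4 * (5 / 96) := by
        have := Real.cos_bound habs
        rw [abs_of_nonneg hd0] at this
        have := (abs_le.1 this).2
        linarith
      rw [FI.mem_def]
      constructor
      · push_cast
        rw [SCZ_cast]
        have hc2 := le_cdiv_mul_real (a := D.sqr.hi) (b := 2) (by norm_num)
        push_cast at hc2
        nlinarith [h2.2, hlow]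
      · push_cast
        rw [SCZ_cast]
        have hf2 := fdiv_mul_le_real (a := D.sqr.lo) (b := 2) (by norm_num)
        have hc96 := le_cdiv_mul_real (a := 5 * D.sqr.sqr.hi) (b := 96) (by norm_num)
        push_cast at hf2 hc96
        have : (d ^ 2) ^ 2 = d ^ 4 := by ring
        rw [this] at h4
        nlinarith [h2.1, h4.2, hup]
    · -- sine
      have h2 : FI.mem (d ^ 2) D.sqr := FI.mem_sqr hd
      have h3 : FI.mem (d ^ 2 * d) (D.sqr.mul D) := FI.mem_mul h2 hd
      have h4 : FI.mem ((d ^ 2) ^ 2) D.sqr.sqr := FI.mem_sqr h2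
      have h5 : FI.mem ((d ^ 2) ^ 2 * d) (D.sqr.sqr.mul D) := FI.mem_mul h4 hd
      have hmain : FI.mem (d - d ^ 2 * d / 6) (D.sub ((D.sqr.mul D).divNat 6)) :=
        FI.mem_sub hd (FI.mem_divNat h3 (by norm_num))
      refine FI.mem_widen hmain ?_
      have hsb := Real.sin_bound habs
      rw [abs_of_nonneg hd0] at hsb
      have : d - d ^ 2 * d / 6 = d - d ^ 3 / 6 := by ring
      rw [this]
      rw [FI.mem_def] at h5
      have hc := le_cdiv_mul_real (a := (D.sqr.sqr.mul D).hi) (b := 100) (by norm_num)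
      push_cast at hc ⊢
      have h5' : d ^ 5 * SC ≤ (D.sqr.sqr.mul D).hi := by
        have : (d ^ 2) ^ 2 * d = d ^ 5 := by ring
        rw [this] at h5; exact h5.2
      have hsc' : |Real.sin d - (d - d ^ 3 / 6)| * SC ≤ d ^ 5 / 100 * SC := by gcongr
      nlinarith [hsc', h5']

/-- `scaleAngle tn td D ∋ τ x` for `x ∈ D`. [folklore] -/
theorem mem_scaleAngle {tn td : ℕ} (htd : 0 < td) {D : FI} {x : ℝ} (hx : FI.mem x D) :
    FI.mem ((tn : ℝ) / td * x) (scaleAngle tn td D) := by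
  have := FI.mem_divNat (FI.mem_mulInt hx tn) htd
  unfold scaleAngle
  convert this using 1
  push_cast
  ring

/-- Arc box `[cos d, 1] × [0, sin d]` contains `e^{iφ}` for `0 ≤ φ ≤ d ≤ 1`. [folklore] -/
theorem mem_arcPos {D c s : FI} {d φ : ℝ} (h : cosSinSmall D = some (c, s)) (hd : FI.mem d D)
    (h0 : 0 ≤ φ) (hφ : φ ≤ d) : CB.mem (Complex.exp ((φ : ℂ) * I)) (arcPos (c, s)) := by
  obtain ⟨hd0, hd1, hc, hs⟩ := cosSinSmall_spec h hd
  have hpi : d ≤ Real.pi := by linarith [Real.pi_gt_three]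
  have hre : (Complex.exp ((φ : ℂ) * I)).re = Real.cos φ := by
    rw [Complex.exp_mul_I]; simp [Complex.cos_ofReal_re, Complex.sin_ofReal_im]
  have him : (Complex.exp ((φ : ℂ) * I)).im = Real.sin φ := by
    rw [Complex.exp_mul_I]; simp [Complex.cos_ofReal_im, Complex.sin_ofReal_re]
  have hsc : (0 : ℝ) < SC := SC_pos
  rw [FI.mem_def] at hc hs
  refine ⟨?_, ?_⟩
  · rw [hre, FI.mem_def]
    simp only [arcPos]
    constructor
    · have : Real.cos d ≤ Real.cos φ :=
        Real.cos_le_cos_of_nonneg_of_le_pi h0 hpi hφ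
      nlinarith [hc.1]
    · rw [SCZ_cast]
      have := Real.cos_le_one φ
      nlinarith
  · rw [him, FI.mem_def]
    simp only [arcPos]
    constructor
    · push_cast
      have : 0 ≤ Real.sin φ := Real.sin_nonneg_of_nonneg_of_le_pi h0 (by linarith)
      positivity
    · have hsin : Real.sin φ ≤ Real.sin d := by
        apply Real.sin_le_sin_of_le_of_le_pi_div_two _ _ hφ
        · linarith [Real.pi_gt_three]
        · linarith [Real.pi_gt_three]
      have hmax : ((s.hi : ℤ) : ℝ) ≤ ((max 0 s.hi : ℤ) : ℝ) := by exact_mod_cast le_max_right 0 s.hi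
      calc Real.sin φ * SC ≤ Real.sin d * SC := by gcongr
        _ ≤ s.hi := hs.2
        _ ≤ ((max 0 s.hi : ℤ) : ℝ) := hmax

/-- Arc box `[cos d, 1] × [−sin d, 0]` contains `e^{−iφ}` for `0 ≤ φ ≤ d ≤ 1`. [folklore] -/
theorem mem_arcNeg {D c s : FI} {d φ : ℝ} (h : cosSinSmall D = some (c, s)) (hd : FI.mem d D)
    (h0 : 0 ≤ φ) (hφ : φ ≤ d) : CB.mem (Complex.exp (((-φ : ℝ) : ℂ) * I)) (arcNeg (c, s)) := by
  have hpos := mem_arcPos h hd h0 hφ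
  have hconj : Complex.exp (((-φ : ℝ) : ℂ) * I) = starRingEnd ℂ (Complex.exp ((φ : ℂ) * I)) := by
    rw [← Complex.exp_conj]
    congr 1
    simp [Complex.conj_ofReal]
  rw [hconj]
  have := CB.mem_conj hpos
  -- `conj (arcPos) = arcNeg` up to the order of the endpoints
  refine ⟨this.1, ?_⟩
  have him := this.2
  rw [FI.mem_def] at him ⊢
  simp only [CB.conj, arcPos, FI.neg] at him
  simp only [arcNeg]
  push_cast at him ⊢
  exact ⟨him.1, by simpa using him.2⟩

/-- Point box of `e^{id}`. [folklore] -/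
theorem mem_rotPos {D c s : FI} {d : ℝ} (h : cosSinSmall D = some (c, s)) (hd : FI.mem d D) :
    CB.mem (Complex.exp ((d : ℂ) * I)) (rotPos (c, s)) := by
  obtain ⟨-, -, hc, hs⟩ := cosSinSmall_spec h hd
  refine ⟨?_, ?_⟩
  · have : (Complex.exp ((d : ℂ) * I)).re = Real.cos d := by
      rw [Complex.exp_mul_I]; simp [Complex.cos_ofReal_re, Complex.sin_ofReal_im]
    rw [this]; exact hc
  · have : (Complex.exp ((d : ℂ) * I)).im = Real.sin d := by
      rw [Complex.exp_mul_I]; simp [Complex.cos_ofReal_im, Complex.sin_ofReal_re]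
    rw [this]; exact hs

/-- Point box of `e^{−id}`. [folklore] -/
theorem mem_rotNeg {D c s : FI} {d : ℝ} (h : cosSinSmall D = some (c, s)) (hd : FI.mem d D) :
    CB.mem (Complex.exp (((-d : ℝ) : ℂ) * I)) (rotNeg (c, s)) := by
  obtain ⟨-, -, hc, hs⟩ := cosSinSmall_spec h hd
  refine ⟨?_, ?_⟩
  · have : (Complex.exp (((-d : ℝ) : ℂ) * I)).re = Real.cos d := by
      rw [Complex.exp_mul_I]; simp [Complex.cos_ofReal_re, Complex.sin_ofReal_im]
    rw [this]; exact hc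
  · have : (Complex.exp (((-d : ℝ) : ℂ) * I)).im = -Real.sin d := by
      rw [Complex.exp_mul_I]; simp [Complex.cos_ofReal_im, Complex.sin_ofReal_re]
    rw [this]; exact FI.mem_neg hs

/-- **`phaseDown`** (`u ≤ v`, `τ = tn/td`, `0 < td`): from `Φ ∋ e^{-iτ log v}`, `Lu ∋ log u`,
`Lv ∋ log v` and a sound optional increment: the first box contains `e^{-iτ y}` for every
`y ∈ [log u, log v]`, the second contains `e^{-iτ log u}`. [folklore] -/
theorem phaseDown_spec {tn td : ℕ} (htd : 0 < td) {Φ : CB} {incr : Option FI} {Lu Lv : FI}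
    {Bbin Bu : CB} (h : phaseDown tn td Φ incr Lu Lv = some (Bbin, Bu)) {lu lv : ℝ}
    (hΦ : CB.mem (phase ((tn : ℝ) / td) lv) Φ) (hLu : FI.mem lu Lu) (hLv : FI.mem lv Lv)
    (hinc : ∀ D, incr = some D → FI.mem (lv - lu) D) :
    (∀ y, lu ≤ y → y ≤ lv → CB.mem (phase ((tn : ℝ) / td) y) Bbin) ∧
      CB.mem (phase ((tn : ℝ) / td) lu) Bu := by
  set τ : ℝ := (tn : ℝ) / td with hτ
  have hτ0 : 0 ≤ τ := div_nonneg (Nat.cast_nonneg tn) (Nat.cast_nonneg td)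
  -- the fallback (two `expI`)
  have fallback : ∀ B Pt, phaseBox tn td Lu Lv = some B → phaseBox tn td Lu Lu = some Pt →
      (∀ y, lu ≤ y → y ≤ lv → CB.mem (phase τ y) B) ∧ CB.mem (phase τ lu) Pt := by
    intro B Pt hB hPt
    rw [FI.mem_def] at hLu hLv
    have hsc : (0 : ℝ) < SC := SC_pos
    refine ⟨fun y hy1 hy2 ↦ mem_phaseBox htd hB ?_ ?_, mem_phaseBox htd hPt hLu.1 hLu.2⟩
    · nlinarith [hLu.1]
    · nlinarith [hLv.2]
  have fallback' : (match phaseBox tn td Lu Lv, phaseBox tn td Lu Lu with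
        | some B, some Pt => some (B, Pt)
        | _, _ => none) = some (Bbin, Bu) →
      (∀ y, lu ≤ y → y ≤ lv → CB.mem (phase τ y) Bbin) ∧ CB.mem (phase τ lu) Bu := by
    intro hm
    split at hm
    · rename_i B Pt hB hPt
      simp only [Option.some.injEq, Prod.mk.injEq] at hm
      obtain ⟨rfl, rfl⟩ := hm
      exact fallback _ _ hB hPt
    · simp at hm
  unfold phaseDown at h
  cases incr with
  | none => exact fallback' h
  | some D =>
    simp only at h
    have hD := hinc D rfl
    generalize hr : (bif decide ((scaleAngle tn td D).hi ≤ ROTMAX) then cosSinSmall (scaleAngle tn td D)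
      else none) = r at h
    cases r with
    | none => exact fallback' h
    | some cs =>
      simp only [Option.some.injEq, Prod.mk.injEq] at h
      obtain ⟨rfl, rfl⟩ := h
      have hcs : cosSinSmall (scaleAngle tn td D) = some cs := by
        cases hb : decide ((scaleAngle tn td D).hi ≤ ROTMAX) <;> rw [hb] at hr
        · simp at hr
        · simpa using hr
      obtain ⟨c, sn⟩ := cs
      have hd : FI.mem (τ * (lv - lu)) (scaleAngle tn td D) := mem_scaleAngle htd hD
      obtain ⟨hd0, -, -, -⟩ := cosSinSmall_spec hcs hd
      refine ⟨fun y hy1 hy2 ↦ ?_, ?_⟩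
      · rw [phase_eq_mul_exp τ y lv]
        refine CB.mem_mul hΦ (mem_arcPos hcs hd ?_ ?_)
        · exact mul_nonneg hτ0 (by linarith)
        · exact mul_le_mul_of_nonneg_left (by linarith) hτ0
      · rw [phase_eq_mul_exp τ lu lv]
        exact CB.mem_mul hΦ (mem_rotPos hcs hd)

/-- **`phaseUp`** (`a ≤ b`): from `Ψ ∋ e^{-iτ log a}`: the first box contains `e^{-iτ y}` for every
`y ∈ [log a, log b]`, the second contains `e^{-iτ log b}`. [folklore] -/
theorem phaseUp_spec {tn td : ℕ} (htd : 0 < td) {Ψ : CB} {incr : Option FI} {La Lb : FI}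
    {Br Bb : CB} (h : phaseUp tn td Ψ incr La Lb = some (Br, Bb)) {la lb : ℝ}
    (hΨ : CB.mem (phase ((tn : ℝ) / td) la) Ψ) (hLa : FI.mem la La) (hLb : FI.mem lb Lb)
    (hinc : ∀ D, incr = some D → FI.mem (lb - la) D) :
    (∀ y, la ≤ y → y ≤ lb → CB.mem (phase ((tn : ℝ) / td) y) Br) ∧
      CB.mem (phase ((tn : ℝ) / td) lb) Bb := by
  set τ : ℝ := (tn : ℝ) / td with hτ
  have hτ0 : 0 ≤ τ := div_nonneg (Nat.cast_nonneg tn) (Nat.cast_nonneg td)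
  have fallback : ∀ B Pt, phaseBox tn td La Lb = some B → phaseBox tn td Lb Lb = some Pt →
      (∀ y, la ≤ y → y ≤ lb → CB.mem (phase τ y) B) ∧ CB.mem (phase τ lb) Pt := by
    intro B Pt hB hPt
    rw [FI.mem_def] at hLa hLb
    have hsc : (0 : ℝ) < SC := SC_pos
    refine ⟨fun y hy1 hy2 ↦ mem_phaseBox htd hB ?_ ?_, mem_phaseBox htd hPt hLb.1 hLb.2⟩
    · nlinarith [hLa.1]
    · nlinarith [hLb.2]
  have fallback' : (match phaseBox tn td La Lb, phaseBox tn td Lb Lb with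
        | some B, some Pt => some (B, Pt)
        | _, _ => none) = some (Br, Bb) →
      (∀ y, la ≤ y → y ≤ lb → CB.mem (phase τ y) Br) ∧ CB.mem (phase τ lb) Bb := by
    intro hm
    split at hm
    · rename_i B Pt hB hPt
      simp only [Option.some.injEq, Prod.mk.injEq] at hm
      obtain ⟨rfl, rfl⟩ := hm
      exact fallback _ _ hB hPt
    · simp at hm
  unfold phaseUp at h
  cases incr with
  | none => exact fallback' h
  | some D =>
    simp only at h
    have hD := hinc D rfl
    generalize hr : (bif decide ((scaleAngle tn td D).hi ≤ ROTMAX) then cosSinSmall (scaleAngle tn td D)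
      else none) = r at h
    cases r with
    | none => exact fallback' h
    | some cs =>
      simp only [Option.some.injEq, Prod.mk.injEq] at h
      obtain ⟨rfl, rfl⟩ := h
      have hcs : cosSinSmall (scaleAngle tn td D) = some cs := by
        cases hb : decide ((scaleAngle tn td D).hi ≤ ROTMAX) <;> rw [hb] at hr
        · simp at hr
        · simpa using hr
      obtain ⟨c, sn⟩ := cs
      have hd : FI.mem (τ * (lb - la)) (scaleAngle tn td D) := mem_scaleAngle htd hD
      obtain ⟨hd0, -, -, -⟩ := cosSinSmall_spec hcs hd
      refine ⟨fun y hy1 hy2 ↦ ?_, ?_⟩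
      · rw [phase_eq_mul_exp_neg τ y la]
        refine CB.mem_mul hΨ (mem_arcNeg hcs hd ?_ ?_)
        · exact mul_nonneg hτ0 (by linarith)
        · exact mul_le_mul_of_nonneg_left (by linarith) hτ0
      · rw [phase_eq_mul_exp_neg τ lb la]
        exact CB.mem_mul hΨ (mem_rotNeg hcs hd)

/-! ### The grid -/

/-- [folklore] -/
theorem gridGo_succ (n g : ℕ) : gridGo (n + 1) g = gridNext (gridGo n g) := by
  induction n generalizing g with
  | zero => rfl
  | succ n ih => rw [gridGo, ih, gridGo]

/-- `g_{i+1} = gridNext g_i`. [folklore] -/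
theorem gridPt_succ (i : ℕ) : gridPt (i + 1) = gridNext (gridPt i) := gridGo_succ i 20

/-- `g_0 = 20`. [folklore] -/
theorem gridPt_zero : gridPt 0 = 20 := rfl

/-- `g < gridNext g`. [folklore] -/
theorem lt_gridNext (g : ℕ) : g < gridNext g := by
  unfold gridNext
  have : 1 ≤ max 1 (g / 50) := le_max_left _ _
  omega

/-- `g_i < g_{i+1}`. [folklore] -/
theorem gridPt_lt_succ (i : ℕ) : gridPt i < gridPt (i + 1) := by
  rw [gridPt_succ]; exact lt_gridNext _

/-- The grid is strictly increasing. [folklore] -/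
theorem gridPt_strictMono : StrictMono gridPt := strictMono_nat_of_lt_succ gridPt_lt_succ

/-- `20 ≤ g_i`. [folklore] -/
theorem twenty_le_gridPt (i : ℕ) : 20 ≤ gridPt i := by
  induction i with
  | zero => simp [gridPt_zero]
  | succ n ih => have := gridPt_lt_succ n; omega

/-- [folklore] -/
theorem gridDescGo_append (n g : ℕ) (acc : List ℕ) : gridDescGo n g acc = gridDescGo n g [] ++ acc := by
  induction n generalizing g acc with
  | zero => simp [gridDescGo]
  | succ n ih =>
    rw [gridDescGo, gridDescGo, ih (gridNext g) (g :: acc), ih (gridNext g) [g]]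
    simp

/-- [folklore] -/
theorem gridDescGo_succ_eq (n a : ℕ) :
    gridDescGo (n + 1) (gridPt a) [] = gridPt (a + n) :: gridDescGo n (gridPt a) [] := by
  induction n generalizing a with
  | zero => simp [gridDescGo]
  | succ n ih =>
    rw [gridDescGo, ← gridPt_succ, gridDescGo_append, ih (a + 1)]
    conv_rhs => rw [gridDescGo, ← gridPt_succ, gridDescGo_append]
    simp only [List.cons_append]
    congr 2
    omega

/-- `gridDesc a a = []`. [folklore] -/
theorem gridDesc_self (a : ℕ) : gridDesc a a = [] := by simp [gridDesc, gridDescGo]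

/-- `gridDesc a (b+1) = g_b :: gridDesc a b` for `a ≤ b`. [folklore] -/
theorem gridDesc_succ {a b : ℕ} (hab : a ≤ b) : gridDesc a (b + 1) = gridPt b :: gridDesc a b := by
  unfold gridDesc
  rw [show b + 1 - a = (b - a) + 1 by omega, gridDescGo_succ_eq]
  congr 2
  omega

/-! ### The table of `H_k(s)` -/

/-- `H_k(s) = zetaPartialSum k s`, with `H_k = H_{k−1} + k^{-s}`. [folklore] -/
theorem zetaPartialSum_succ' (k : ℕ) (s : ℂ) :
    zetaPartialSum (k + 1) s = zetaPartialSum k s + ((k + 1 : ℕ) : ℂ) ^ (-s) := by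
  rw [zetaPartialSum_succ]; push_cast; ring

/-- Invariant of the table builder. With `τ = tn/td`, `s = 1 + iτ`: if, at the entry with index
`m ≥ 1`, `H ∋ H_{m−1}(s)`, `acc = [H_{m−1}, …, H_1]`-boxes (each `acc[j] ∋ H_{m−1−j}`),
`L ∋ log(m−1)` and `Φ ∋ (m−1)^{-iτ}` (with `log 0 = 0`), then the result lists boxes of
`H_{m−1+fuel}, …, H_1` and its flag certifies `Re(H_{j−1}·conj(j^{-iτ})) ≥ 0` for the new indices
`j ≥ 2`. [folklore] -/
theorem hTabGo_spec {tn td : ℕ} (htd : 0 < td) :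
    ∀ (fuel m : ℕ) (L : FI) (Φ H : CB) (acc : List CB) (mono : Bool) (tab : List CB) (mono' : Bool),
      hTabGo tn td fuel m L Φ H acc mono = some (tab, mono') → 1 ≤ m →
      CB.mem (zetaPartialSum (m - 1) (sOf ((tn : ℝ) / td))) H →
      FI.mem (Real.log ((m - 1 : ℕ) : ℝ)) L →
      CB.mem (phase ((tn : ℝ) / td) (Real.log ((m - 1 : ℕ) : ℝ))) Φ →
      acc.length = m - 1 →
      (∀ j, 1 ≤ j → j ≤ m - 1 → CB.mem (zetaPartialSum j (sOf ((tn : ℝ) / td)))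
        (acc.getD (m - 1 - j) (CB.ofInt 0))) →
      tab.length = m - 1 + fuel ∧
      (∀ j, 1 ≤ j → j ≤ m - 1 + fuel → CB.mem (zetaPartialSum j (sOf ((tn : ℝ) / td)))
        (tab.getD (m - 1 + fuel - j) (CB.ofInt 0))) ∧
      (mono' = true → mono = true ∧ ∀ j, m ≤ j → 2 ≤ j → j ≤ m - 1 + fuel →
        0 ≤ (zetaPartialSum (j - 1) (sOf ((tn : ℝ) / td)) *
          starRingEnd ℂ (phase ((tn : ℝ) / td) (Real.log j))).re)
  | 0, m, L, Φ, H, acc, mono, tab, mono', h, hm, _, _, _, hlen, hacc => by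
    simp only [hTabGo, Option.some.injEq, Prod.mk.injEq] at h
    obtain ⟨rfl, rfl⟩ := h
    refine ⟨by simpa using hlen, by simpa using hacc, fun hmono ↦ ⟨hmono, fun j h1 _ h3 ↦ by omega⟩⟩
  | fuel + 1, m, L, Φ, H, acc, mono, tab, mono', h, hm, hH, hL, hΦ, hlen, hacc => by
    set τ : ℝ := (tn : ℝ) / td with hτdef
    rw [hTabGo] at h
    split at h
    · simp at h
    · rename_i L' incr hlog
      split at h
      · simp at h
      · rename_i rng Φ' hph
        simp only [Bool.cond_eq_ite] at h
        split at h
        · -- the logarithm and the phase at `m`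
          obtain ⟨hL', hinc⟩ := logUp_spec hlog (Nat.sub_le m 1) (fun _ ↦ hL)
          have hph' : CB.mem (phase τ (Real.log m)) Φ' :=
            (phaseUp_spec htd hph hΦ hL hL' (fun D hD ↦ (hinc D hD).2)).2
          -- the new box `H' ∋ H_m`
          have hterm : CB.mem (((m : ℂ)) ^ (-(sOf τ))) (Φ'.divNat m) := by
            rw [natCast_cpow_neg_sOf (by omega) τ]
            have := CB.mem_divNat hph' (show 0 < m by omega)
            convert this using 1
            rw [div_eq_mul_inv, mul_comm]
          have hH' : CB.mem (zetaPartialSum m (sOf τ)) (H.add (Φ'.divNat m)) := by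
            have hm' : m = (m - 1) + 1 := by omega
            rw [hm', zetaPartialSum_succ', ← hm']
            exact CB.mem_add hH hterm
          -- recurse
          have hrec := hTabGo_spec htd fuel (m + 1) L' Φ' (H.add (Φ'.divNat m))
            (H.add (Φ'.divNat m) :: acc) _ tab mono' h (by omega)
            (by simpa using hH') (by simpa using hL') (by simpa using hph')
            (by simp [hlen]; omega)
            (by
              intro j hj1 hj2
              simp only [Nat.add_sub_cancel] at hj2 ⊢
              rcases Nat.eq_or_lt_of_le hj2 with rfl | hlt
              · simp only [Nat.sub_self, List.getD_cons_zero]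
                exact hH'
              · have : m - j = (m - 1 - j) + 1 := by omega
                rw [this, List.getD_cons_succ]
                exact hacc j hj1 (by omega))
          obtain ⟨hlen', hget', hmono'⟩ := hrec
          refine ⟨by rw [hlen']; omega, fun j hj1 hj2 ↦ ?_, fun hm' ↦ ?_⟩
          · have := hget' j hj1 (by omega)
            rwa [show m + 1 - 1 + fuel - j = m - 1 + (fuel + 1) - j by omega] at this
          · obtain ⟨hmono1, hall⟩ := hmono' hm'
            simp only [Bool.and_eq_true, Bool.or_eq_true, Nat.ble_eq, decide_eq_true_eq] at hmono1
            obtain ⟨hmono0, htest⟩ := hmono1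
            refine ⟨hmono0, fun j hj1 hj2 hj3 ↦ ?_⟩
            rcases Nat.eq_or_lt_of_le hj1 with rfl | hlt
            · -- the test at `m` itself
              rcases htest with hle1 | hpos
              · omega
              · have hprod := CB.mem_mul hH (CB.mem_conj hph')
                have := hprod.1
                rw [FI.mem_def] at this
                have h0 : (0 : ℝ) ≤ ((H.mul Φ'.conj).re.lo : ℝ) := by exact_mod_cast hpos
                have hsc : (0 : ℝ) < SC := SC_pos
                nlinarith [this.1]
            · exact hall j hlt hj2 (by omega)
        · simp at h

/-- **The table.** `hTab tn td k0 = some (tab, mono)` (`0 < td`): `tab` has length `k0`,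
`hTabGet tab k0 k ∋ H_k(s)` for `1 ≤ k ≤ k0`, and if `mono = true` then `‖H_{k−1}(s)‖ ≤ ‖H_k(s)‖`
for `2 ≤ k ≤ k0`. [folklore] -/
theorem hTab_spec {tn td k0 : ℕ} (htd : 0 < td) {tab : List CB} {mono : Bool}
    (h : hTab tn td k0 = some (tab, mono)) :
    tab.length = k0 ∧
    (∀ k, 1 ≤ k → k ≤ k0 → CB.mem (zetaPartialSum k (sOf ((tn : ℝ) / td))) (hTabGet tab k0 k)) ∧
    (mono = true → ∀ k, 2 ≤ k → k ≤ k0 →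
      ‖zetaPartialSum (k - 1) (sOf ((tn : ℝ) / td))‖ ≤ ‖zetaPartialSum k (sOf ((tn : ℝ) / td))‖) := by
  set τ : ℝ := (tn : ℝ) / td
  unfold hTab at h
  have hspec := hTabGo_spec htd k0 1 (FI.ofInt 0) (CB.ofInt 1) (CB.ofInt 0) [] true tab mono h
    le_rfl (by simpa using CB.mem_ofInt 0) (by simpa using FI.mem_ofInt 0)
    (by simpa [phase] using CB.mem_ofInt 1) rfl (fun j hj1 hj2 ↦ by omega)
  obtain ⟨hlen, hget, hmono⟩ := hspec
  simp only [Nat.sub_self, Nat.zero_add] at hlen hget hmono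
  refine ⟨hlen, fun k hk1 hk2 ↦ ?_, fun hm k hk2 hk0 ↦ ?_⟩
  · unfold hTabGet; exact hget k hk1 hk2
  · obtain ⟨-, hall⟩ := hmono hm
    have hre := hall k (by omega) hk2 hk0
    -- `|H_k|² = |H_{k-1}|² + 2 Re(H_{k-1} conj(k^{-s})) + |k^{-s}|² ≥ |H_{k-1}|²`
    have hk : k = (k - 1) + 1 := by omega
    have hHk : zetaPartialSum k (sOf τ) = zetaPartialSum (k - 1) (sOf τ) + (k : ℂ) ^ (-(sOf τ)) := by
      conv_lhs => rw [hk, zetaPartialSum_succ']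
      rw [Nat.sub_add_cancel (by omega : 1 ≤ k)]
    have hks : (k : ℂ) ^ (-(sOf τ)) = ((k : ℂ))⁻¹ * phase τ (Real.log k) :=
      natCast_cpow_neg_sOf (by omega) τ
    set A := zetaPartialSum (k - 1) (sOf τ)
    set w := (k : ℂ) ^ (-(sOf τ))
    have hsq : ‖A + w‖ ^ 2 = ‖A‖ ^ 2 + 2 * (A * starRingEnd ℂ w).re + ‖w‖ ^ 2 := by
      rw [Complex.sq_norm, Complex.sq_norm, Complex.sq_norm, Complex.normSq_add]
      simp only [Complex.mul_re, Complex.conj_re, Complex.conj_im]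
      ring
    have hre' : 0 ≤ (A * starRingEnd ℂ w).re := by
      rw [hks, map_mul]
      have : starRingEnd ℂ (((k : ℂ))⁻¹) = ((k : ℂ))⁻¹ := by
        rw [map_inv₀, Complex.conj_natCast]
      rw [this, ← mul_assoc, mul_comm A, mul_assoc]
      rw [show ((k : ℂ))⁻¹ = (((k : ℝ)⁻¹ : ℝ) : ℂ) by push_cast; rfl, Complex.re_ofReal_mul]
      exact mul_nonneg (by positivity) hre
    rw [hHk]
    have : ‖A‖ ^ 2 ≤ ‖A + w‖ ^ 2 := by rw [hsq]; nlinarith [norm_nonneg w, sq_nonneg ‖w‖]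
    exact (pow_le_pow_iff_left₀ (norm_nonneg _) (norm_nonneg _) two_ne_zero).1 this

/-- [folklore] -/
theorem mem_hTabHullGo {tab : List CB} {k0 : ℕ} {s : ℂ}
    (hget : ∀ k, 1 ≤ k → k ≤ k0 → CB.mem (zetaPartialSum k s) (hTabGet tab k0 k)) :
    ∀ (n a : ℕ) (B : CB), 1 ≤ a → a + n ≤ k0 →
      (∀ k, a ≤ k → k ≤ a → CB.mem (zetaPartialSum k s) B) →
      ∀ (P : ℕ → Prop), (∀ k, P k ↔ CB.mem (zetaPartialSum k s) B ∨ (a < k ∧ k ≤ a + n)) →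
      ∀ k, P k → CB.mem (zetaPartialSum k s) (hTabHullGo tab k0 n (a + 1) B)
  | 0, a, B, _, _, hB, P, hP, k, hk => by
    rw [hTabHullGo]
    rcases (hP k).1 hk with h | h
    · exact h
    · omega
  | n + 1, a, B, ha, han, hB, P, hP, k, hk => by
    rw [hTabHullGo]
    have hstep := mem_hTabHullGo hget n (a + 1) (hullCB B (hTabGet tab k0 (a + 1))) (by omega)
      (by omega)
      (fun k hk1 hk2 ↦ by
        have : k = a + 1 := by omega
        subst this
        exact mem_hullCB_right (hget (a + 1) (by omega) (by omega)) _)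
      (fun k ↦ CB.mem (zetaPartialSum k s) (hullCB B (hTabGet tab k0 (a + 1))) ∨
        (a + 1 < k ∧ k ≤ a + 1 + n)) (fun k ↦ Iff.rfl) k
    rw [show a + 1 + 1 = a + 2 by ring] at hstep
    rw [show a + 1 + 1 = a + 2 by ring]
    apply hstep
    rcases (hP k).1 hk with h | h
    · exact Or.inl (mem_hullCB_left h _)
    · rcases Nat.lt_or_ge (a + 1) k with hlt | hge
      · exact Or.inr ⟨hlt, by omega⟩
      · have : k = a + 1 := by omega
        subst this
        exact Or.inl (mem_hullCB_right (hget (a + 1) (by omega) (by omega)) _)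

/-- **Hull of table boxes**: for `1 ≤ a ≤ b ≤ k0` and `a ≤ k ≤ b`, `hTabHull tab k0 a b ∋ H_k(s)`. [folklore] -/
theorem mem_hTabHull {tab : List CB} {k0 : ℕ} {s : ℂ}
    (hget : ∀ k, 1 ≤ k → k ≤ k0 → CB.mem (zetaPartialSum k s) (hTabGet tab k0 k))
    {a b k : ℕ} (ha : 1 ≤ a) (hab : a ≤ b) (hb : b ≤ k0) (hk1 : a ≤ k) (hk2 : k ≤ b) :
    CB.mem (zetaPartialSum k s) (hTabHull tab k0 a b) := by
  unfold hTabHull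
  refine mem_hTabHullGo hget (b - a) a (hTabGet tab k0 a) ha (by omega)
    (fun k hk1 hk2 ↦ by
      have : k = a := by omega
      subst this; exact hget k ha (by omega))
    (fun k ↦ CB.mem (zetaPartialSum k s) (hTabGet tab k0 a) ∨ (a < k ∧ k ≤ a + (b - a)))
    (fun k ↦ Iff.rfl) k ?_
  rcases Nat.eq_or_lt_of_le hk1 with rfl | hlt
  · exact Or.inl (hget a ha (by omega))
  · exact Or.inr ⟨hlt, by omega⟩

/-! ### The Euler–Maclaurin box -/

/-- `absS tn td ∋ 1 + τ²/2 ≥ ‖s‖`. [folklore] -/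
theorem norm_sOf_le_absS_hi {tn td : ℕ} (htd : 0 < td) :
    ‖sOf ((tn : ℝ) / td)‖ * SC ≤ ((absS tn td).hi : ℝ) := by
  have hmem : FI.mem (1 + ((tn : ℝ) / td) ^ 2 / 2) (absS tn td) := by
    unfold absS
    have h1 := FI.mem_ofInt 1
    have h2 : FI.mem ((tn : ℝ) / td) (FI.ofFrac tn td) := by
      have := FI.mem_ofFrac (tn : ℤ) htd
      simpa using this
    have := FI.mem_add h1 (FI.mem_divNat (FI.mem_sqr h2) (by norm_num : 0 < 2))
    convert this using 1
    push_cast; ring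
  rw [FI.mem_def] at hmem
  have hle := norm_sOf_le ((tn : ℝ) / td)
  have hsc : (0 : ℝ) < SC := SC_pos
  nlinarith [hmem.2]

/-- `emErr ≥ ‖s‖(k₀⁻² + k₀⁻¹)·2^48`. [folklore] -/
theorem emErr_ge {tn td k0 : ℕ} (htd : 0 < td) (hk0 : 0 < k0) :
    ‖sOf ((tn : ℝ) / td)‖ * (((k0 : ℝ))⁻¹ ^ 2 + ((k0 : ℝ))⁻¹) * SC ≤ (emErr tn td k0 : ℝ) := by
  unfold emErr
  set e := (absS tn td).mul ((FI.ofFrac 1 (k0 * k0)).add (FI.ofFrac 1 k0)) with he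
  have hmem : FI.mem ((1 + ((tn : ℝ) / td) ^ 2 / 2) * (((k0 : ℝ))⁻¹ ^ 2 + ((k0 : ℝ))⁻¹)) e := by
    have h1 : FI.mem (1 + ((tn : ℝ) / td) ^ 2 / 2) (absS tn td) := by
      unfold absS
      have ha := FI.mem_ofInt 1
      have hb : FI.mem ((tn : ℝ) / td) (FI.ofFrac tn td) := by
        have := FI.mem_ofFrac (tn : ℤ) htd
        simpa using this
      have := FI.mem_add ha (FI.mem_divNat (FI.mem_sqr hb) (by norm_num : 0 < 2))
      convert this using 1
      push_cast; ring
    have h2 : FI.mem (((k0 : ℝ))⁻¹ ^ 2 + ((k0 : ℝ))⁻¹) ((FI.ofFrac 1 (k0 * k0)).add (FI.ofFrac 1 k0)) := by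
      have ha := FI.mem_ofFrac (1 : ℤ) (Nat.mul_pos hk0 hk0)
      have hb := FI.mem_ofFrac (1 : ℤ) hk0
      have := FI.mem_add ha hb
      convert this using 1
      push_cast
      field_simp
    exact FI.mem_mul h1 h2
  rw [FI.mem_def] at hmem
  have hle := norm_sOf_le ((tn : ℝ) / td)
  have hpos : (0 : ℝ) ≤ ((k0 : ℝ))⁻¹ ^ 2 + ((k0 : ℝ))⁻¹ := by positivity
  have hsc : (0 : ℝ) < SC := SC_pos
  have : ‖sOf ((tn : ℝ) / td)‖ * (((k0 : ℝ))⁻¹ ^ 2 + ((k0 : ℝ))⁻¹) * SC ≤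
      (1 + ((tn : ℝ) / td) ^ 2 / 2) * (((k0 : ℝ))⁻¹ ^ 2 + ((k0 : ℝ))⁻¹) * SC := by gcongr
  calc _ ≤ (e.hi : ℝ) := this.trans hmem.2
    _ ≤ ((max 0 e.hi : ℤ) : ℝ) := by exact_mod_cast le_max_right _ _

/-- **The Euler–Maclaurin box.** For `k ≥ k₀ ≥ 1`, `0 < tn`, `0 < td` (`τ = tn/td > 0`): if
`Hk0 ∋ H_{k₀}(s)`, `Ψ ∋ k^{-iτ}` and `Ψ₀ ∋ k₀^{-iτ}`, then `emBox tn td k0 Hk0 Ψ Ψ₀ ∋ H_k(s)`.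
[cite: MontgomeryVaughan2007, Thm. 1.12] -/
theorem mem_emBox {tn td k0 k : ℕ} (htn : 0 < tn) (htd : 0 < td) (hk0 : 1 ≤ k0) (hk : k0 ≤ k)
    {Hk0 Ψ Ψ0 : CB} (hH : CB.mem (zetaPartialSum k0 (sOf ((tn : ℝ) / td))) Hk0)
    (hΨ : CB.mem (phase ((tn : ℝ) / td) (Real.log k)) Ψ)
    (hΨ0 : CB.mem (phase ((tn : ℝ) / td) (Real.log k0)) Ψ0) :
    CB.mem (zetaPartialSum k (sOf ((tn : ℝ) / td))) (emBox tn td k0 Hk0 Ψ Ψ0) := by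
  set τ : ℝ := (tn : ℝ) / td with hτdef
  have hτ0 : 0 < τ := div_pos (by exact_mod_cast htn) (by exact_mod_cast htd)
  have hs1 : sOf τ ≠ 1 := sOf_ne_one hτ0.ne'
  -- the closed form `(k^{1-s} - k0^{1-s})/(1-s) = (Ψ - Ψ0)·i/τ`
  have hmain : CB.mem (((k : ℂ) ^ (1 - sOf τ) / (1 - sOf τ) - (k0 : ℂ) ^ (1 - sOf τ) / (1 - sOf τ)))
      (emMain tn td Ψ Ψ0) := by
    unfold emMain
    have hd := CB.mem_divNat (CB.mem_mulInt (CB.mem_mulI (CB.mem_sub hΨ hΨ0)) (td : ℤ)) htn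
    convert hd using 1
    rw [natCast_cpow_one_sub_sOf (by omega) τ, natCast_cpow_one_sub_sOf (by omega) τ, one_sub_sOf,
      ← sub_div]
    have hτc : (τ : ℂ) ≠ 0 := by exact_mod_cast hτ0.ne'
    have htn' : ((tn : ℕ) : ℂ) ≠ 0 := by exact_mod_cast htn.ne'
    have htd' : ((td : ℕ) : ℂ) ≠ 0 := by exact_mod_cast htd.ne'
    rw [hτdef]
    push_cast
    field_simp
    ring_nf
    rw [Complex.I_sq]
    ring
  have hsum : CB.mem (zetaPartialSum k0 (sOf τ) +
      ((k : ℂ) ^ (1 - sOf τ) / (1 - sOf τ) - (k0 : ℂ) ^ (1 - sOf τ) / (1 - sOf τ)))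
      (Hk0.add (emMain tn td Ψ Ψ0)) := CB.mem_add hH hmain
  unfold emBox
  refine CB.mem_widen hsum ?_
  have hEM := norm_zetaPartialSum_sub_sub_le (sOf_re τ) hs1 hk0 hk
  have herr := emErr_ge (tn := tn) (k0 := k0) htd (by omega)
  have hsc : (0 : ℝ) < SC := SC_pos
  calc ‖zetaPartialSum k (sOf τ) - (zetaPartialSum k0 (sOf τ) +
        ((k : ℂ) ^ (1 - sOf τ) / (1 - sOf τ) - (k0 : ℂ) ^ (1 - sOf τ) / (1 - sOf τ)))‖ * SC
      = ‖zetaPartialSum k (sOf τ) - zetaPartialSum k0 (sOf τ) -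
          ((k : ℂ) ^ (1 - sOf τ) / (1 - sOf τ) - (k0 : ℂ) ^ (1 - sOf τ) / (1 - sOf τ))‖ * SC := by
        congr 2; ring
    _ ≤ ‖sOf τ‖ * (((k0 : ℝ))⁻¹ ^ 2 + ((k0 : ℝ))⁻¹) * SC := by gcongr
    _ ≤ (emErr tn td k0 : ℝ) := herr

end Literature.Barriers.RiemannHypothesis.TuranWindow
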